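import Summits.BirchSwinnertonDyer.BirchSwinnertonDyer.Theses.QuadraticBranchSignedControl
import Summits.BirchSwinnertonDyer.BirchSwinnertonDyer.Theses.InertBadSignedBranches
import HarnessLib

/-!
# Route `InertBadSignedBranches`, aside item stmt-BirchSwinnertonDyer-19116 `PAdicGrossZagierBranch`:
# DEF-FREE bridges — the route's copy of the decl ⟺ the `QuadraticBranchSignedControl` copy ⟺ the
# two REGISTERED stubs of skeleton `c61e79f0579b1b1e` (`stub_gz_nonvanishing`, `stub_gz_valuation`)

WHAT. Item 19116 is wanted by two routes whose route files declare `PAdicGrossZagierBranch` with the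
SAME body `∀ W p, Additive.QuadraticBranchMinusLeadingValuationAt W p 0` (the pre-registered valuation
law P2♭ for the linear coefficient of Kobayashi's minus function `L_p⁻(V, η, X)` on the quadratic
branch, instantiated at dictionary offset `δ = 0`). Its registered skeleton
(`Cruxes/PAdicGrossZagierBranch/Lines/birth.lean`, sha `c61e79f0579b1b1e`) cuts the node into
`stub_gz_nonvanishing` (`coeff₁ L ≠ 0` in analytic rank one — the signed `p`-adic height
non-degeneracy, a declared residual) and `stub_gz_valuation` (the valuation law GIVEN non-vanishing).
This file records, in the Theorems tree and BY NAME, with the stub statements displayed VERBATIM as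
hypotheses (no `def`, no `abbrev`):
* §1 the two route copies are the same proposition (`Iff.rfl`);
* §2 the `InertBadSignedBranches` copy ⟺ (`stub_gz_nonvanishing` ∧ `stub_gz_valuation`) — the stub
  set is complete (⟸, the skeleton's composition) and each stub is a consequence of the crux (⟹), so
  the cut loses nothing and adds nothing.

HONEST LABEL. Bookkeeping only: both stubs are OPEN (the `η`-branch `p`-adic Gross–Zagier formula at
an additive prime is not in print — Kobayashi 2013 is at good primes; the offset `δ` of the tree's
`coeff₁ L` versus the engine reading `δ = −1` is an open dictionary entry, see the node's module
docstring); nothing here proves either stub, the item stays OPEN, nothing is booked, no label moves,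
BSD is proved for no curve. `--supports stmt-BirchSwinnertonDyer-19116`.

References: [Kobayashi2003] §3 (3.5)–(3.7) (p. 7), §4 (p. 8); [Kobayashi2013] Cor. 1.3 (shape only);
[KuriharaPollack2007] §2.6 (2.5); [Miller2011LMS] §1.
-/

set_option linter.dupNamespace false

noncomputable section

open scoped Classical MatrixGroups ModularForm

open CongruenceSubgroup WeierstrassCurve
open Literature.NumberTheory.EllipticCurves
open Literature.NumberTheory.EllipticCurves.ModularForms
open Literature.NumberTheory.EllipticCurves.Rank1Residual
open Literature.NumberTheory.EllipticCurves.Rank1Residual.Typed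
open Summit.BirchSwinnertonDyer.Rank1Residual Summit.BirchSwinnertonDyer.Rank1Residual.Additive

namespace Summit.BirchSwinnertonDyer.BirchSwinnertonDyer.Theorems

/-! ## §1 One proposition, two route copies -/

/-- The `InertBadSignedBranches` copy and the `QuadraticBranchSignedControl` copy of
`PAdicGrossZagierBranch` have identical bodies (`∀ W p, QuadraticBranchMinusLeadingValuationAt W p 0`):
they are the same proposition, so every theorem about one serves the other BY NAME. Bookkeeping.
[cite: Kobayashi2003, §3 (3.5)–(3.7) (p. 7); shape only] -/
theorem inertBadSignedBranches_pAdicGrossZagierBranch_iff_quadraticBranchSignedControl :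
    Summit.BirchSwinnertonDyer.BirchSwinnertonDyer.Theses.InertBadSignedBranches.PAdicGrossZagierBranch ↔
      Summit.BirchSwinnertonDyer.BirchSwinnertonDyer.Theses.QuadraticBranchSignedControl.PAdicGrossZagierBranch :=
  Iff.rfl

/-! ## §2 The crux versus its two registered stubs (statements displayed verbatim) -/

/-- **The `InertBadSignedBranches` copy of `PAdicGrossZagierBranch` FROM the two registered stubs of
skeleton `c61e79f0579b1b1e`** — `hnv` is the statement of `stub_gz_nonvanishing` and `hval` that of
`stub_gz_valuation`, VERBATIM (non-vanishing of `coeff₁ L`, then the valuation law at offset `0`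
given non-vanishing). The skeleton's composition `PAdicGrossZagierBranch_inert_of`, recorded in the
Theorems tree. CONDITIONAL on both displayed inputs (both OPEN); closes nothing.
[cite: Kobayashi2003, §3 (3.5)–(3.7) (p. 7) and §4 (p. 8); shape only] -/
theorem inertBadSignedBranches_pAdicGrossZagierBranch_of_stubs
    (hnv : ∀ (W : WeierstrassCurve ℚ) [W.IsElliptic] [W.IsGloballyMinimal] (p : ℕ) [Fact p.Prime],
      ∀ (V : WeierstrassCurve ℚ) [V.IsElliptic] [V.IsGloballyMinimal] (C : VariableChange ℚ)
        {N : ℕ} [NeZero N] {f : CuspForm (Gamma0 N) 2},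
        5 ≤ p → C • W.quadraticTwist ((-1) ^ (p / 2) * p) = V →
        V.HasGoodReductionAtPrime p → V.frobeniusTrace p = 0 → W.analyticRank = 1 →
        IsNewformOf V f →
        ∀ (ϖ : ℚ), (if Even (p / 2) then (ϖ : ℝ) * V.realPeriodRat = plusPeriod f
            else (ϖ : ℝ) * V.imaginaryPeriodRat = minusPeriod f) →
        ∀ (L : IwasawaAlgebra p), Additive.IsQuadraticBranchMinusLFunction f p ϖ L →
        (∀ Q : (W.baseChange ℚ_[p]).toAffine.Point, p • Q = 0 → Q = 0) →
        ∀ (P : W.toAffine.Point) (n : ℕ), ¬ IsOfFinAddOrder P →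
        (∀ R : W.toAffine.Point, ∃ (k : ℤ) (T : W.toAffine.Point),
          IsOfFinAddOrder T ∧ R = k • P + T) →
        (∃ Q : (W.baseChange ℚ_[p]).toAffine.Point, p ^ n • Q = W.toPadicPoint p P) →
        (∀ Q : (W.baseChange ℚ_[p]).toAffine.Point, p ^ (n + 1) • Q ≠ W.toPadicPoint p P) →
        ∀ (q : ℚ), shaAn W = (q : ℂ) →
        PowerSeries.coeff 1 L ≠ 0)
    (hval : ∀ (W : WeierstrassCurve ℚ) [W.IsElliptic] [W.IsGloballyMinimal] (p : ℕ) [Fact p.Prime],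
      ∀ (V : WeierstrassCurve ℚ) [V.IsElliptic] [V.IsGloballyMinimal] (C : VariableChange ℚ)
        {N : ℕ} [NeZero N] {f : CuspForm (Gamma0 N) 2},
        5 ≤ p → C • W.quadraticTwist ((-1) ^ (p / 2) * p) = V →
        V.HasGoodReductionAtPrime p → V.frobeniusTrace p = 0 → W.analyticRank = 1 →
        IsNewformOf V f →
        ∀ (ϖ : ℚ), (if Even (p / 2) then (ϖ : ℝ) * V.realPeriodRat = plusPeriod f
            else (ϖ : ℝ) * V.imaginaryPeriodRat = minusPeriod f) →
        ∀ (L : IwasawaAlgebra p), Additive.IsQuadraticBranchMinusLFunction f p ϖ L →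
        (∀ Q : (W.baseChange ℚ_[p]).toAffine.Point, p • Q = 0 → Q = 0) →
        ∀ (P : W.toAffine.Point) (n : ℕ), ¬ IsOfFinAddOrder P →
        (∀ R : W.toAffine.Point, ∃ (k : ℤ) (T : W.toAffine.Point),
          IsOfFinAddOrder T ∧ R = k • P + T) →
        (∃ Q : (W.baseChange ℚ_[p]).toAffine.Point, p ^ n • Q = W.toPadicPoint p P) →
        (∀ Q : (W.baseChange ℚ_[p]).toAffine.Point, p ^ (n + 1) • Q ≠ W.toPadicPoint p P) →
        ∀ (q : ℚ), shaAn W = (q : ℂ) →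
        PowerSeries.coeff 1 L ≠ 0 →
          ((PowerSeries.coeff 1 L : ℤ_[p]) : ℚ_[p]).valuation =
            2 * (n : ℤ) + padicValRat p (q * W.tamagawaProduct / (W.torsionOrder : ℚ) ^ 2) + 0) :
    Summit.BirchSwinnertonDyer.BirchSwinnertonDyer.Theses.InertBadSignedBranches.PAdicGrossZagierBranch := by
  intro W _ _ p _ V _ _ C N _ f hp5 hCV hgood hap hr hf ϖ hϖ L hL htor P n hP hgen hdiv hndiv q hq
  have h1 := hnv W p V C hp5 hCV hgood hap hr hf ϖ hϖ L hL htor P n hP hgen hdiv hndiv q hq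
  exact ⟨h1, hval W p V C hp5 hCV hgood hap hr hf ϖ hϖ L hL htor P n hP hgen hdiv hndiv q hq h1⟩

/-- **Conversely, each registered stub is a consequence of the crux**: the `InertBadSignedBranches`
copy of `PAdicGrossZagierBranch` gives the statement of `stub_gz_nonvanishing` (first conjunct of the
node) and that of `stub_gz_valuation` (second conjunct; its extra hypothesis `coeff₁ L ≠ 0` is then
idle). With `inertBadSignedBranches_pAdicGrossZagierBranch_of_stubs`: crux ⟺ (both stubs) — the
skeleton's cut is lossless. Bookkeeping; both sides OPEN; closes nothing.
[cite: Kobayashi2003, §3 (3.5)–(3.7) (p. 7) and §4 (p. 8); shape only] -/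
theorem inertBadSignedBranches_pAdicGrossZagierBranch_iff_stubs :
    Summit.BirchSwinnertonDyer.BirchSwinnertonDyer.Theses.InertBadSignedBranches.PAdicGrossZagierBranch ↔
      ((∀ (W : WeierstrassCurve ℚ) [W.IsElliptic] [W.IsGloballyMinimal] (p : ℕ) [Fact p.Prime],
        ∀ (V : WeierstrassCurve ℚ) [V.IsElliptic] [V.IsGloballyMinimal] (C : VariableChange ℚ)
          {N : ℕ} [NeZero N] {f : CuspForm (Gamma0 N) 2},
          5 ≤ p → C • W.quadraticTwist ((-1) ^ (p / 2) * p) = V →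
          V.HasGoodReductionAtPrime p → V.frobeniusTrace p = 0 → W.analyticRank = 1 →
          IsNewformOf V f →
          ∀ (ϖ : ℚ), (if Even (p / 2) then (ϖ : ℝ) * V.realPeriodRat = plusPeriod f
              else (ϖ : ℝ) * V.imaginaryPeriodRat = minusPeriod f) →
          ∀ (L : IwasawaAlgebra p), Additive.IsQuadraticBranchMinusLFunction f p ϖ L →
          (∀ Q : (W.baseChange ℚ_[p]).toAffine.Point, p • Q = 0 → Q = 0) →
          ∀ (P : W.toAffine.Point) (n : ℕ), ¬ IsOfFinAddOrder P →
          (∀ R : W.toAffine.Point, ∃ (k : ℤ) (T : W.toAffine.Point),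
            IsOfFinAddOrder T ∧ R = k • P + T) →
          (∃ Q : (W.baseChange ℚ_[p]).toAffine.Point, p ^ n • Q = W.toPadicPoint p P) →
          (∀ Q : (W.baseChange ℚ_[p]).toAffine.Point, p ^ (n + 1) • Q ≠ W.toPadicPoint p P) →
          ∀ (q : ℚ), shaAn W = (q : ℂ) →
          PowerSeries.coeff 1 L ≠ 0) ∧
      (∀ (W : WeierstrassCurve ℚ) [W.IsElliptic] [W.IsGloballyMinimal] (p : ℕ) [Fact p.Prime],
        ∀ (V : WeierstrassCurve ℚ) [V.IsElliptic] [V.IsGloballyMinimal] (C : VariableChange ℚ)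
          {N : ℕ} [NeZero N] {f : CuspForm (Gamma0 N) 2},
          5 ≤ p → C • W.quadraticTwist ((-1) ^ (p / 2) * p) = V →
          V.HasGoodReductionAtPrime p → V.frobeniusTrace p = 0 → W.analyticRank = 1 →
          IsNewformOf V f →
          ∀ (ϖ : ℚ), (if Even (p / 2) then (ϖ : ℝ) * V.realPeriodRat = plusPeriod f
              else (ϖ : ℝ) * V.imaginaryPeriodRat = minusPeriod f) →
          ∀ (L : IwasawaAlgebra p), Additive.IsQuadraticBranchMinusLFunction f p ϖ L →
          (∀ Q : (W.baseChange ℚ_[p]).toAffine.Point, p • Q = 0 → Q = 0) →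
          ∀ (P : W.toAffine.Point) (n : ℕ), ¬ IsOfFinAddOrder P →
          (∀ R : W.toAffine.Point, ∃ (k : ℤ) (T : W.toAffine.Point),
            IsOfFinAddOrder T ∧ R = k • P + T) →
          (∃ Q : (W.baseChange ℚ_[p]).toAffine.Point, p ^ n • Q = W.toPadicPoint p P) →
          (∀ Q : (W.baseChange ℚ_[p]).toAffine.Point, p ^ (n + 1) • Q ≠ W.toPadicPoint p P) →
          ∀ (q : ℚ), shaAn W = (q : ℂ) →
          PowerSeries.coeff 1 L ≠ 0 →
            ((PowerSeries.coeff 1 L : ℤ_[p]) : ℚ_[p]).valuation =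
              2 * (n : ℤ) + padicValRat p (q * W.tamagawaProduct / (W.torsionOrder : ℚ) ^ 2) + 0)) := by
  constructor
  · intro h
    refine ⟨?_, ?_⟩
    · intro W _ _ p _ V _ _ C N _ f hp5 hCV hgood hap hr hf ϖ hϖ L hL htor P n hP hgen hdiv hndiv q hq
      exact (h W p V C hp5 hCV hgood hap hr hf ϖ hϖ L hL htor P n hP hgen hdiv hndiv q hq).1
    · intro W _ _ p _ V _ _ C N _ f hp5 hCV hgood hap hr hf ϖ hϖ L hL htor P n hP hgen hdiv hndiv q hq _
      exact (h W p V C hp5 hCV hgood hap hr hf ϖ hϖ L hL htor P n hP hgen hdiv hndiv q hq).2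
  · rintro ⟨hnv, hval⟩
    exact inertBadSignedBranches_pAdicGrossZagierBranch_of_stubs hnv hval

end Summit.BirchSwinnertonDyer.BirchSwinnertonDyer.Theorems

end
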